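import Summits.ValiantsHypothesis.ValiantsHypothesis.Theorems.BarrierLeverPartitionMinorsChowProductStateTables
import Summits.ValiantsHypothesis.ValiantsHypothesis.Theorems.BarrierLeverPartitionMinorsHitByVPMaxPlus

/-!
# Route BarrierLever — Chow witnesses for partition minors (item 20172, CPM): the SYMMETRIC-FORMS
# design hits every layout with a UNIQUE MAXIMUM-OVERLAP assignment (every height, every size)

Helper file (`--supports stmt-ValiantsHypothesis-20172`; cell valiant-natproofs, rung V4, 𝒟-side of
door (c); seat valiant-natproofs-prover gen 12).  Closes NO item; definition-free.  A second all-`h`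
infinite sub-class of planner valiant-natproofs-p1 g15's conjecture `ChowHitsSymmetricForms`
(director-valiant g7, round close 2026-08-27T13:24Z, row 8), after the principal-type class of
`…ChowSymmetricFormsPrincipal` (which it contains).

THE OVERLAP DESIGN.  Symmetric forms `1 + b (x_a + y_a)` and `1 + (1 − b)(x_a + y_a)` for every `a`
(`β (castAdd a) = b e_a`, `β (natAdd a) = (1 − b) e_a`): the site table of
`(1 + b s)(1 + (1 − b) s)`, `s = x + y`, is `(1, 1, 1, q)` with `q = 2b(1 − b)`, so the partition
matrix is the OVERLAP KERNEL `coeff_{x^u y^w} f = q^{|u ∩ w|}` (`coeff_partitionExpo_prod_pairedSites`,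
`…ChowProductStateTables`).  In `ℂ[X]` the minor `det[X^{|u_i ∩ w_j|}]` is nonzero as soon as ONE
permutation `σ₀` is the strict maximiser of the total overlap `Σ_j |u_{σ j} ∩ w_j|` (val-np-p3's
tropical lemma `ProductStateSums.det_sumPow_ne_zero_of_unique_max`, one term per entry); composing
with the non-constant `q(b) = 2b(1 − b)` and using that `ℂ` is infinite gives a good `b`.

* `symmetricForms_hit_of_uniqueMaxOverlap` — **if some `σ₀` uniquely maximises
  `Σ_j #(u (σ j) ∩ w j)`, then some choice of the symmetric design has a nonzero partition minor on
  `(u, w)`** (the conclusion of `ChowHitsSymmetricForms` for the layout).  Examples: principal-type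
  layouts `w = u ∘ κ` with distinct rows (the maximiser pairs each set with itself), containment
  layouts `u_i ⊆ w_{κ i}` with a unique containment matching, and their unions over disjoint
  coordinate blocks.

WHAT THIS IS NOT: layouts with tied maximal overlap assignments (the symmetric cores) are untouched;
`ChowHitsSymmetricForms` / item 20172 stay OPEN; nothing on crux stmt-ValiantsHypothesis-14610 or on
`VP` versus `VNP`.
-/

set_option linter.dupNamespace false

namespace Summit.ValiantsHypothesis.ValiantsHypothesis.Theorems.BarrierLever.ChowFactor

open Finset MvPolynomial
open Summit.ValiantsHypothesis.ValiantsHypothesis.Theorems.BarrierLever.ProductStateSums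
  (det_sumPow_ne_zero_of_unique_max)

noncomputable section

variable {h : ℕ}

/-- The overlap table test with a pairing `π`: `∏_a (q if [a∈u] ∧ [π a∈w] else 1) = q^{#{a ∈ u | π a ∈ w}}`. -/
theorem prod_overlapTable_eq (π : Equiv.Perm (Fin h)) (q : ℂ) (u w : Finset (Fin h)) :
    (∏ a : Fin h, (if decide (a ∈ u) = true ∧ decide (π a ∈ w) = true then q else 1)) =
      q ^ (u.filter fun a => π a ∈ w).card := by
  classical
  rw [Finset.prod_ite, Finset.prod_const_one, mul_one, Finset.prod_const]
  congr 1
  congr 1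
  ext a
  simp [Finset.mem_filter]

/-- The symmetric overlap forms, multiplied out as paired affine sites. -/
theorem prod_symmetricOverlapForms_eq (b : ℂ) :
    (∏ k : Fin (h + h), (1 + ∑ a, C ((Fin.addCases (motive := fun _ => Fin h → ℂ)
        (fun a₀ a => if a = a₀ then b else 0) (fun a₀ a => if a = a₀ then 1 - b else 0) k) a) *
          (X (Fin.castAdd h a) + X (Fin.natAdd h a)) : MvPolynomial (Fin (h + h)) ℂ)) =
      ∏ a : Fin h, ((C 1 + C b * X (Fin.castAdd h a) + C b * X (Fin.natAdd h ((Equiv.refl _) a))) *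
        (C 1 + C (1 - b) * X (Fin.castAdd h a) + C (1 - b) * X (Fin.natAdd h ((Equiv.refl _) a)))) := by
  classical
  rw [Fin.prod_univ_add, ← Finset.prod_mul_distrib]
  refine Finset.prod_congr rfl fun a _ => ?_
  simp only [Fin.addCases_left, Fin.addCases_right, Equiv.refl_apply]
  have hsum : ∀ c : ℂ, (∑ a' : Fin h, C (if a' = a then c else 0) *
      (X (Fin.castAdd h a') + X (Fin.natAdd h a')) : MvPolynomial (Fin (h + h)) ℂ) =
      C c * (X (Fin.castAdd h a) + X (Fin.natAdd h a)) := by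
    intro c
    rw [Finset.sum_eq_single a]
    · rw [if_pos rfl]
    · intro a' _ ha'; rw [if_neg ha', C_0, zero_mul]
    · intro ha; exact absurd (Finset.mem_univ a) ha
  rw [hsum, hsum, C_1]
  ring

/-- The partition matrix of the symmetric overlap design is the overlap kernel `q^{|u ∩ w|}`,
`q = 2b(1 − b)`. -/
theorem coeff_partitionExpo_symmetricOverlap (b : ℂ) (u w : Finset (Fin h)) :
    coeff (∑ a ∈ u, Finsupp.single (Fin.castAdd h a) 1 + ∑ c ∈ w, Finsupp.single (Fin.natAdd h c) 1)
        (∏ k : Fin (h + h), (1 + ∑ a, C ((Fin.addCases (motive := fun _ => Fin h → ℂ)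
          (fun a₀ a => if a = a₀ then b else 0) (fun a₀ a => if a = a₀ then 1 - b else 0) k) a) *
            (X (Fin.castAdd h a) + X (Fin.natAdd h a)) : MvPolynomial (Fin (h + h)) ℂ)) =
      (2 * b * (1 - b)) ^ (u ∩ w).card := by
  classical
  rw [prod_symmetricOverlapForms_eq,
    coeff_partitionExpo_prod_pairedSites (Equiv.refl _) (fun _ => 1) (fun _ => b) (fun _ => b)
      (fun _ => 1) (fun _ => 1 - b) (fun _ => 1 - b)
      (fun _ ε η => if ε = true ∧ η = true then 2 * b * (1 - b) else 1)
      (fun a => by simp) (fun a => by simp) (fun a => by simp) (fun a => by simp; ring),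
    prod_overlapTable_eq (Equiv.refl (Fin h))]
  have hf : (u.filter fun a => (Equiv.refl (Fin h)) a ∈ w) = u ∩ w := by
    ext a
    simp [Finset.mem_filter, Finset.mem_inter]
  rw [hf]

/-- The polynomial `q(b) = 2b(1 − b)` is not constant. -/
theorem overlapParam_ne_C :
    (Polynomial.C (2 : ℂ) * Polynomial.X * (1 - Polynomial.X) : Polynomial ℂ) ≠
      Polynomial.C ((Polynomial.C (2 : ℂ) * Polynomial.X * (1 - Polynomial.X) : Polynomial ℂ).coeff 0) := by
  intro hQ
  have h1 := congrArg (Polynomial.eval (2⁻¹ : ℂ)) hQ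
  have h0 := congrArg (Polynomial.eval (0 : ℂ)) hQ
  simp only [Polynomial.eval_mul, Polynomial.eval_C, Polynomial.eval_X, Polynomial.eval_sub,
    Polynomial.eval_one] at h1 h0
  rw [← h0] at h1
  norm_num at h1

/-- **THE SYMMETRIC DESIGN HITS EVERY LAYOUT WITH A UNIQUE MAXIMUM-OVERLAP ASSIGNMENT (every `h`,
every `r`).**  If a permutation `σ₀` is the strict maximiser of `σ ↦ Σ_j #(u (σ j) ∩ w j)`, then for
some `b` the symmetric forms `1 + b(x_a + y_a)`, `1 + (1 − b)(x_a + y_a)` have a nonzero partition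
minor on `(u, w)`: the conclusion of `ChowHitsSymmetricForms` for this layout. -/
theorem symmetricForms_hit_of_uniqueMaxOverlap {r : ℕ} (u w : Fin r → Finset (Fin h))
    (σ₀ : Equiv.Perm (Fin r))
    (huniq : ∀ σ : Equiv.Perm (Fin r), σ ≠ σ₀ →
      ∑ j, (u (σ j) ∩ w j).card < ∑ j, (u (σ₀ j) ∩ w j).card) :
    ∃ β : Fin (h + h) → Fin h → ℂ,
      (Matrix.of fun i j : Fin r => MvPolynomial.coeff
        (∑ a ∈ u i, Finsupp.single (Fin.castAdd h a) 1 + ∑ c ∈ w j, Finsupp.single (Fin.natAdd h c) 1)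
        (∏ k, (1 + ∑ a, C (β k a) * (X (Fin.castAdd h a) + X (Fin.natAdd h a)) :
          MvPolynomial (Fin (h + h)) ℂ))).det ≠ 0 := by
  classical
  -- Step 1: the overlap minor is a nonzero polynomial in the kernel parameter
  set A : Matrix (Fin r) (Fin r) (Polynomial ℂ) :=
    Matrix.of fun i j : Fin r => (Polynomial.X : Polynomial ℂ) ^ (u i ∩ w j).card with hA
  have hAdet : A.det ≠ 0 := by
    have key := det_sumPow_ne_zero_of_unique_max (m := 1) Nat.one_pos
      (fun _ i j => (u i ∩ w j).card) σ₀ (fun σ hσ => by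
        simp only [Finset.sup_const Finset.univ_nonempty]
        exact huniq σ hσ)
    have hAeq : (Matrix.of fun i j : Fin r => ∑ _k : Fin 1, (Polynomial.X : Polynomial ℂ) ^
        (u i ∩ w j).card) = A := by
      ext i j
      rw [Matrix.of_apply, hA, Matrix.of_apply, Fin.sum_univ_one]
    rw [hAeq] at key
    exact key
  -- Step 2: compose with `q(b) = 2b(1-b)` and pick a good `b` (ℂ is infinite)
  set Q : Polynomial ℂ := Polynomial.C (2 : ℂ) * Polynomial.X * (1 - Polynomial.X) with hQ
  have hcomp : A.det.comp Q ≠ 0 := by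
    rw [Ne, Polynomial.comp_eq_zero_iff, not_or]
    exact ⟨hAdet, fun hh => overlapParam_ne_C hh.2⟩
  obtain ⟨b, hb⟩ : ∃ b : ℂ, (A.det.comp Q).eval b ≠ 0 := by
    by_contra hnone
    push Not at hnone
    exact hcomp (Polynomial.funext fun b => by rw [hnone b, Polynomial.eval_zero])
  rw [Polynomial.eval_comp] at hb
  have hq : Q.eval b = 2 * b * (1 - b) := by
    simp [hQ]
  rw [hq] at hb
  -- Step 3: the symmetric overlap design with this `b`
  refine ⟨Fin.addCases (motive := fun _ => Fin h → ℂ)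
    (fun a₀ a => if a = a₀ then b else 0) (fun a₀ a => if a = a₀ then 1 - b else 0), ?_⟩
  have hM : (Matrix.of fun i j : Fin r => MvPolynomial.coeff
        (∑ a ∈ u i, Finsupp.single (Fin.castAdd h a) 1 + ∑ c ∈ w j, Finsupp.single (Fin.natAdd h c) 1)
        (∏ k : Fin (h + h), (1 + ∑ a, C ((Fin.addCases (motive := fun _ => Fin h → ℂ)
          (fun a₀ a => if a = a₀ then b else 0) (fun a₀ a => if a = a₀ then 1 - b else 0) k) a) *
            (X (Fin.castAdd h a) + X (Fin.natAdd h a)) : MvPolynomial (Fin (h + h)) ℂ))) =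
      (Polynomial.evalRingHom (2 * b * (1 - b))).mapMatrix A := by
    ext i j
    rw [Matrix.of_apply, coeff_partitionExpo_symmetricOverlap, RingHom.mapMatrix_apply,
      Matrix.map_apply, hA, Matrix.of_apply, Polynomial.coe_evalRingHom, Polynomial.eval_pow,
      Polynomial.eval_X]
  rw [hM, ← RingHom.map_det, Polynomial.coe_evalRingHom]
  exact hb

end

end Summit.ValiantsHypothesis.ValiantsHypothesis.Theorems.BarrierLever.ChowFactor
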